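import Literature.Computability.AlgebraicComplexity.BLMW11WeaklySkewDegree
import Literature.Computability.AlgebraicComplexity.ArithCircuitProofs
import Literature.Computability.AlgebraicComplexity.ValiantClasses
import Literature.Computability.AlgebraicComplexity.SkewCircuitFormalDegree
import Literature.Computability.AlgebraicComplexity.BurgisserBooleanPartsA3Steps
import HarnessLib

/-!
# Multiplicatively disjoint circuits (Malod–Portier 2008; Bürgisser 2024 survey, Def. 2.5)
# — definition + PROOFS of the degree bound (Lemma 4.1(1)) and of Remark 2.8

Topic `Computability/AlgebraicComplexity`. Cell `val-lit`, row Bur2024-A (P. Bürgisser,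
*Completeness classes in algebraic complexity theory*, arXiv:2406.06217, 2024; held text
`paper:arxiv-2406.06217`, p0005 L107–L120, p0006 L24, L58–L61, p0015 L33–L39), with
[cite: MalodPortier2008, §2] as the original source of the notion:

> **Definition 2.5.** An arithmetic circuit `Φ` is called *multiplicatively disjoint* if, for each
> multiplication gate `v` with children `v₁, v₂`, the subcircuits `Φ_{v₁}` and `Φ_{v₂}` are
> disjoint. By induction one shows that `deg(v) ≤ |Φ_v| + 1`. Hence the size of a multiplicatively
> disjoint circuit provides a bound on its degree and hence on the degrees of the polynomials
> computed by it.
> **Remark 2.8(1).** … Note that weakly-skew circuits are multiplicatively disjoint …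
> **Definition 2.9(1).** The complexity class `VP^𝔽` is defined as the set of sequences `(f_n)` …
> such that there exists a sequence `(Φ_n)` of multiplicatively disjoint arithmetic circuits over
> `𝔽` such that `Φ_n` computes `f_n` and the size `|Φ_n|` is bounded by a polynomial in `n`.
> **Lemma 4.1.** We have `deg(Φ̂_v) ≤ |Φ_v| + 1` … for all gates `v` of a multiplicatively disjoint
> (constant-free) arithmetic circuit `Φ`.

What is here (theorems only, no named facts, no `sorry`; D-0026):

* `ArithCircuit.IsMultiplicativelyDisjoint` — Def. 2.5 in the tree's straight-line model
  (`ArithCircuit`, sub-circuits `ArithCircuit.subcircuit` of BLMW 2011 §9.1): at every product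
  gate the sub-circuits below its gate operands are pairwise disjoint. As for `IsWeaklySkew`, input
  operands (`var`/`const`) are private leaves of the gate using them, so they impose no condition
  (the survey obtains the same effect "by copying input gates", Rem. 2.8(1)).
* `ArithCircuit.isMultiplicativelyDisjoint_of_isWeaklySkew` — **Remark 2.8(1)**: a well-formed
  fan-in-two weakly-skew circuit is multiplicatively disjoint (the unique-exit-edge condition makes
  the separate multiplicand's module disjoint from the other factor's sub-circuit,
  `disjoint_subcircuit_of_isSeparateOperand`).
* `ArithCircuit.totalDegree_gateValue_le_of_isMultiplicativelyDisjoint` — **Lemma 4.1(1) / the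
  induction after Def. 2.5**: gate `j` of a well-formed fan-in-two multiplicatively disjoint circuit
  computes a polynomial of total degree `≤ |C_j| + 1` (`C_j` = the set of GATES below `j`; the
  survey's `Φ_v` also contains input vertices, so this is the printed bound or sharper);
  `ArithCircuit.totalDegree_eval_le_of_isMultiplicativelyDisjoint` — hence
  `deg P.eval ≤ P.size + 1`. This generalises `totalDegree_gateValue_le` /
  `totalDegree_eval_le_of_isWeaklySkew` (`BLMW11WeaklySkewDegree.lean`) from weakly-skew to
  multiplicatively disjoint circuits, with the same proof.
* `isVPFamily_of_isMultiplicativelyDisjoint` — the survey's **Def. 2.9(1)** lands inside the tree's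
  `IsVPFamily` (Bürgisser 2000, Def. 2.4: p-family of p-bounded complexity, i.e. the
  characterisation of Rem. 2.10(1)): a family in p-bounded many variables computed by well-formed
  fan-in-two multiplicatively disjoint circuits of p-bounded size is in `VP`.
  -- TODO(general form): the converse inclusion is Prop. 2.6 [MalodPortier2008]: a circuit of size
  -- `s` computing `f` yields a multiplicatively disjoint one of size `O(s · deg Φ)`; not typed here.

Honest framing: textbook properties of the model (vocabulary of the survey's §2.2); `VP ≠ VNP` is
NOT proved and nothing here bears on it.
-/

namespace Literature.Computability.AlgebraicComplexity

namespace ArithCircuit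

open MvPolynomial

section Def

variable {k : Type*} {σ : Type*}

/-- **Multiplicatively disjoint circuit (Bürgisser 2024, Def. 2.5; Malod–Portier 2008):** "for each
multiplication gate `v` with children `v₁, v₂`, the subcircuits `Φ_{v₁}` and `Φ_{v₂}` are
disjoint." In the straight-line model: at every product gate, the sub-circuits `C_j`
(`ArithCircuit.subcircuit`) below its gate operands `gate j` are pairwise disjoint (as a list: a
repeated operand `gate j, gate j` is excluded, since `j ∈ C_j`); input operands are private leaves
and impose no condition. Intended for fan-in-two circuits (`IsFanInTwo`), as in print.
[cite: Burgisser2024Completeness, Def. 2.5] -/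
def IsMultiplicativelyDisjoint (P : ArithCircuit k σ) : Prop :=
  ∀ (i : ℕ) (args : List (Operand k σ)), P.gates[i]? = some (.prod args) →
    (Gate.prod args).refs.Pairwise fun j j' => Disjoint (P.subcircuit j) (P.subcircuit j')

variable (P : ArithCircuit k σ)

/-- Unfolding of `IsMultiplicativelyDisjoint`. [cite: Burgisser2024Completeness, Def. 2.5] -/
theorem isMultiplicativelyDisjoint_iff :
    P.IsMultiplicativelyDisjoint ↔
      ∀ (i : ℕ) (args : List (Operand k σ)), P.gates[i]? = some (.prod args) →
        (Gate.prod args).refs.Pairwise fun j j' => Disjoint (P.subcircuit j) (P.subcircuit j') :=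
  Iff.rfl

/-- The gate references of a binary product of two gates. [cite: Burgisser2000, Def. 2.1] -/
@[simp]
theorem refs_prod_pair (β γ : ℕ) :
    (Gate.prod [Operand.gate β, Operand.gate γ] : Gate k σ).refs = [β, γ] := by
  simp [Gate.refs, Gate.args]

/-- At a product gate `gate β * gate γ` of a multiplicatively disjoint circuit the two factor
sub-circuits are disjoint. [cite: Burgisser2024Completeness, Def. 2.5] -/
theorem IsMultiplicativelyDisjoint.disjoint_of_pair {P : ArithCircuit k σ}
    (hmd : P.IsMultiplicativelyDisjoint) {i β γ : ℕ}
    (hg : P.gates[i]? = some (.prod [.gate β, .gate γ])) :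
    Disjoint (P.subcircuit β) (P.subcircuit γ) := by
  have h := hmd i _ hg
  rw [refs_prod_pair, List.pairwise_pair] at h
  exact h

/-- In particular a multiplicatively disjoint circuit never multiplies a gate by itself.
[cite: Burgisser2024Completeness, Def. 2.5] -/
theorem IsMultiplicativelyDisjoint.ne_of_pair {P : ArithCircuit k σ}
    (hmd : P.IsMultiplicativelyDisjoint) {i β γ : ℕ}
    (hg : P.gates[i]? = some (.prod [.gate β, .gate γ])) : β ≠ γ := by
  rintro rfl
  have h := hmd.disjoint_of_pair hg
  rw [Set.disjoint_iff] at h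
  exact h ⟨self_mem_subcircuit P β, self_mem_subcircuit P β⟩

/-- A circuit without gates is multiplicatively disjoint. [cite: Burgisser2024Completeness, Def. 2.5] -/
theorem isMultiplicativelyDisjoint_of_gates_eq_nil (h : P.gates = []) :
    P.IsMultiplicativelyDisjoint := by
  intro i args hg
  simp [h] at hg

/-- At a product gate `i` of a well-formed circuit whose operands are `gate β, gate γ` (in either
order) with `gate β` a SEPARATE multiplicand (BLMW 2011 §9.1), the factor sub-circuits are disjoint
(and `γ ≠ β`, since `β` is referenced exactly once). [cite: BurgisserEtAl2011, §9.1 (weakly-skew circuits)] -/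
theorem disjoint_subcircuit_of_isSeparateOperand_pair (hwf : P.WellFormed) {i β γ : ℕ}
    {args : List (Operand k σ)} (hg : P.gates[i]? = some (.prod args))
    (hargs : args = [.gate β, .gate γ] ∨ args = [.gate γ, .gate β])
    (hsep : P.IsSeparateOperand i β) : Disjoint (P.subcircuit β) (P.subcircuit γ) := by
  have hβmem : Operand.gate β ∈ (Gate.prod args).args := by
    rcases hargs with rfl | rfl <;> simp [Gate.args]
  have hγmem : Operand.gate γ ∈ (Gate.prod args).args := by
    rcases hargs with rfl | rfl <;> simp [Gate.args]
  have hβref : P.References i β := ⟨_, hg, (mem_refs_iff _ β).2 hβmem⟩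
  have hγref : P.References i γ := ⟨_, hg, (mem_refs_iff _ γ).2 hγmem⟩
  have hβlt : β < i := lt_of_references P hwf hβref
  have hiβ : i ∉ P.subcircuit β := fun h => lt_irrefl i ((subcircuit_le P hwf h).trans_lt hβlt)
  have hc := hsep i hiβ _ hg β (self_mem_subcircuit P β)
  rw [if_pos ⟨rfl, rfl⟩] at hc
  have hne : γ ≠ β := by
    intro hγβ
    rw [hγβ] at hargs
    have h2c : (Gate.prod args).refs.count β = 2 := by
      rcases hargs with rfl | rfl <;> simp [Gate.refs, Gate.args]
    omega
  exact disjoint_subcircuit_of_isSeparateOperand P hwf hsep hβref hγref hne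

/-- **Bürgisser 2024, Remark 2.8(1): "weakly-skew circuits are multiplicatively disjoint"** — for
well-formed fan-in-two circuits of the straight-line model (at a product gate `gate β * gate γ`
one factor, say `β`, is a separate multiplicand, and the unique-exit-edge condition makes
`C_β ∩ C_γ = ∅`). [cite: Burgisser2024Completeness, Rem. 2.8(1)] -/
theorem isMultiplicativelyDisjoint_of_isWeaklySkew (hwf : P.WellFormed) (h2 : P.IsFanInTwo)
    (hws : P.IsWeaklySkew) : P.IsMultiplicativelyDisjoint := by
  intro i args hg
  have hfan : args.length ≤ 2 := by
    have := h2 (.prod args) (List.mem_of_getElem? hg)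
    simpa [Gate.fanIn, Gate.args] using this
  rcases args with _ | ⟨u₁, _ | ⟨u₂, _ | ⟨u₃, rest⟩⟩⟩
  · simp [Gate.refs, Gate.args]
  · cases u₁ <;> simp [Gate.refs, Gate.args]
  · cases u₁ with
    | var x => cases u₂ <;> simp [Gate.refs, Gate.args]
    | const c => cases u₂ <;> simp [Gate.refs, Gate.args]
    | gate β =>
      cases u₂ with
      | var x => simp [Gate.refs, Gate.args]
      | const c => simp [Gate.refs, Gate.args]
      | gate γ =>
        rw [refs_prod_pair, List.pairwise_pair]
        obtain ⟨u, hu, hcase⟩ := hws i [.gate β, .gate γ] hg (by simp)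
        simp only [List.mem_cons, List.not_mem_nil, or_false] at hu
        rcases hcase with hin | ⟨δ, hδ, hsep⟩
        · rcases hu with rfl | rfl <;> simp [Operand.isGateRef] at hin
        · rcases hu with rfl | rfl
          · simp only [Operand.gate.injEq] at hδ
            subst hδ
            exact disjoint_subcircuit_of_isSeparateOperand_pair P hwf hg (Or.inl rfl) hsep
          · simp only [Operand.gate.injEq] at hδ
            subst hδ
            exact (disjoint_subcircuit_of_isSeparateOperand_pair P hwf hg (Or.inr rfl) hsep).symm
  · simp at hfan

/-- Counting at a product gate with disjoint factor sub-circuits: if gate `α` references `β` and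
`γ` and `C_β ∩ C_γ = ∅`, then `|C_β| + |C_γ| + 1 ≤ |C_α|` (well-formed circuits).
[cite: Burgisser2024Completeness, Def. 2.5 (the induction `deg(v) ≤ |Φ_v| + 1`)] -/
theorem ncard_subcircuit_add_le_of_disjoint (hwf : P.WellFormed) {α β γ : ℕ}
    (hβ : P.References α β) (hγ : P.References α γ)
    (hdisj : Disjoint (P.subcircuit β) (P.subcircuit γ)) :
    (P.subcircuit β).ncard + (P.subcircuit γ).ncard + 1 ≤ (P.subcircuit α).ncard := by
  have hfinβ := subcircuit_finite P hwf β
  have hfinγ := subcircuit_finite P hwf γ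
  have hα : α ∉ P.subcircuit β ∪ P.subcircuit γ := by
    rintro (h | h)
    · exact lt_irrefl α ((subcircuit_le P hwf h).trans_lt (lt_of_references P hwf hβ))
    · exact lt_irrefl α ((subcircuit_le P hwf h).trans_lt (lt_of_references P hwf hγ))
  rw [← Set.ncard_union_eq hdisj hfinβ hfinγ,
    ← Set.ncard_insert_of_notMem hα (hfinβ.union hfinγ)]
  refine Set.ncard_le_ncard ?_ (subcircuit_finite P hwf α)
  rintro x (rfl | hx | hx)
  · exact self_mem_subcircuit P _
  · exact subcircuit_subset_of_references P hβ hx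
  · exact subcircuit_subset_of_references P hγ hx

end Def

/-! ## Lemma 4.1(1): the degree bound -/

section Degree

variable {k : Type*} [CommSemiring k] {σ : Type*}

/-- Evaluating a longer gate list extends the list of values. [cite: Burgisser2000, Def. 2.1] -/
private theorem exists_gateValues_append_eq' (l₁ l₂ : List (Gate k σ)) :
    ∃ r, gateValues (l₁ ++ l₂) = gateValues l₁ ++ r ∧ r.length = l₂.length := by
  induction l₂ using List.reverseRecOn with
  | nil => exact ⟨[], by simp, rfl⟩
  | append_singleton l₂ g ih =>
    obtain ⟨r, hr, hlen⟩ := ih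
    refine ⟨r ++ [g.eval (gateValues (l₁ ++ l₂))], ?_, by simp [hlen]⟩
    rw [← List.append_assoc, gateValues_append_singleton, hr, List.append_assoc]

/-- The value of gate `p` is its evaluation against the values of the earlier gates.
[cite: Burgisser2000, Def. 2.1] -/
private theorem getD_gateValues_eq_eval (gs : List (Gate k σ)) (p : ℕ) (g : Gate k σ)
    (hg : gs[p]? = some g) :
    (gateValues gs).getD p 0 = g.eval (gateValues (gs.take p)) := by
  obtain ⟨hp, hpg⟩ := List.getElem?_eq_some_iff.1 hg
  have hsplit : gs = (gs.take p ++ [g]) ++ gs.drop (p + 1) := by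
    rw [List.append_assoc, List.singleton_append, ← hpg, ← List.drop_eq_getElem_cons hp,
      List.take_append_drop]
  obtain ⟨r, hr, -⟩ := exists_gateValues_append_eq' (gs.take p ++ [g]) (gs.drop (p + 1))
  rw [← hsplit, gateValues_append_singleton] at hr
  have hlen : (gateValues (gs.take p)).length = p := by
    rw [gateValues_length, List.length_take]
    omega
  rw [List.getD_eq_getElem?_getD, hr, List.append_assoc, List.getElem?_append_right (by omega),
    hlen, Nat.sub_self]
  simp

/-- Earlier values seen from gate `p` are the final values. [cite: Burgisser2000, Def. 2.1] -/
private theorem getD_gateValues_take_of_lt (gs : List (Gate k σ)) {i p : ℕ} (hi : i < p) :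
    (gateValues (gs.take p)).getD i 0 = (gateValues gs).getD i 0 := by
  obtain ⟨r, hr, -⟩ := exists_gateValues_append_eq' (gs.take p) (gs.drop p)
  rw [List.take_append_drop] at hr
  rw [hr, List.getD_eq_getElem?_getD, List.getD_eq_getElem?_getD]
  by_cases hi' : i < (gateValues (gs.take p)).length
  · rw [List.getElem?_append_left hi']
  · have hlen : (gateValues (gs.take p)).length = min p gs.length := by
      rw [gateValues_length, List.length_take]
    have htake : gs.take p = gs := List.take_of_length_le (by omega)
    rw [htake] at hr ⊢
    have hr' : r = [] := by
      have h := congrArg List.length hr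
      simp only [List.length_append] at h
      exact List.eq_nil_of_length_eq_zero (by omega)
    rw [hr', List.append_nil]

/-- Degrees of a list sum. [folklore] -/
private theorem totalDegree_list_sum_le' {l : List (MvPolynomial σ k)} {n : ℕ}
    (h : ∀ x ∈ l, x.totalDegree ≤ n) : l.sum.totalDegree ≤ n := by
  induction l with
  | nil => simp
  | cons a l ih =>
    rw [List.sum_cons]
    refine (totalDegree_add a l.sum).trans (max_le (h a (by simp)) (ih fun x hx => h x (by simp [hx])))

variable (P : ArithCircuit k σ)

/-- **Bürgisser 2024, Lemma 4.1(1) (and the induction after Def. 2.5): gate `j` of a well-formed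
fan-in-two multiplicatively disjoint circuit computes a polynomial of total degree at most
`|C_j| + 1`** (`C_j` = the gates below `j`; the survey's `Φ_v` also counts input vertices, so the
printed `deg(v) ≤ |Φ_v| + 1` follows). At a product gate `j = u · u'`: an input factor has degree
`≤ 1`; two gate factors `β, γ` have disjoint proper sub-circuits, so
`(|C_β| + 1) + (|C_γ| + 1) ≤ |C_j| + 1`. Stated for arbitrary coefficients (the survey's Lemma 4.1
is the constant-free case, same proof). [cite: Burgisser2024Completeness, Lemma 4.1(1)] -/
theorem totalDegree_gateValue_le_of_isMultiplicativelyDisjoint (hwf : P.WellFormed)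
    (h2 : P.IsFanInTwo) (hmd : P.IsMultiplicativelyDisjoint) :
    ∀ j : ℕ, j < P.size →
      ((gateValues P.gates).getD j 0).totalDegree ≤ (P.subcircuit j).ncard + 1 := by
  intro j
  induction j using Nat.strong_induction_on with
  | _ j ih =>
  intro hj
  obtain ⟨g, hg⟩ : ∃ g, P.gates[j]? = some g := ⟨P.gates[j]'hj, List.getElem?_eq_getElem hj⟩
  rw [getD_gateValues_eq_eval P.gates j g hg]
  have hone : 1 ≤ (P.subcircuit j).ncard :=
    (Set.ncard_pos (subcircuit_finite P hwf j)).2 ⟨j, self_mem_subcircuit P j⟩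
  -- degree of an INPUT operand: at most `1`
  have hopIn : ∀ u : Operand k σ, u.isGateRef = false →
      (u.eval (gateValues (P.gates.take j))).totalDegree ≤ 1 := by
    intro u hin
    cases u with
    | var i => exact (isHomogeneous_X k i).totalDegree_le
    | const c => simp [Operand.eval]
    | gate i => simp [Operand.isGateRef] at hin
  -- degree of a GATE operand `gate i` of `g`: at most `|C_i| + 1`, and `|C_i| + 1 ≤ |C_j|`
  have hopGate' : ∀ i : ℕ, Operand.gate i ∈ g.args →
      ((Operand.gate i : Operand k σ).eval (gateValues (P.gates.take j))).totalDegree ≤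
        (P.subcircuit i).ncard + 1 := by
    intro i hu
    have hub : i < j := hwf.1 j g hg (.gate i) hu
    simp only [Operand.eval_gate]
    rw [getD_gateValues_take_of_lt P.gates hub]
    exact ih i hub (hub.trans hj)
  have hopGate : ∀ i : ℕ, Operand.gate i ∈ g.args →
      ((Operand.gate i : Operand k σ).eval (gateValues (P.gates.take j))).totalDegree ≤
        (P.subcircuit j).ncard := by
    intro i hu
    have href : P.References j i := ⟨g, hg, (mem_refs_iff g i).2 hu⟩
    have h1 := hopGate' i hu
    have h2 := ncard_subcircuit_succ_le P hwf href
    omega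
  have hop' : ∀ u ∈ g.args, (u.eval (gateValues (P.gates.take j))).totalDegree ≤
      (P.subcircuit j).ncard := by
    intro u hu
    cases u with
    | var i => exact (hopIn _ rfl).trans hone
    | const c => exact (hopIn _ rfl).trans hone
    | gate i => exact hopGate i hu
  cases g with
  | sum args =>
    -- a sum gate: degree ≤ max over its operands
    simp only [Gate.eval]
    refine (totalDegree_list_sum_le' (n := (P.subcircuit j).ncard) fun x hx => ?_).trans (by omega)
    obtain ⟨a, ha, rfl⟩ := List.mem_map.1 hx
    refine (totalDegree_smul_le _ _).trans (hop' a.2 ?_)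
    simp only [Gate.args]
    exact List.mem_map.2 ⟨a, ha, rfl⟩
  | prod args =>
    have hfan : args.length ≤ 2 := by
      have := h2 (.prod args) (List.mem_of_getElem? hg)
      simpa [Gate.fanIn, Gate.args] using this
    simp only [Gate.eval]
    rcases args with _ | ⟨u₁, _ | ⟨u₂, _ | ⟨u₃, rest⟩⟩⟩
    · simp
    · simp only [List.map_cons, List.map_nil, List.prod_cons, List.prod_nil, mul_one]
      exact (hop' u₁ (by simp [Gate.args])).trans (by omega)
    · simp only [List.map_cons, List.map_nil, List.prod_cons, List.prod_nil, mul_one]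
      refine (totalDegree_mul _ _).trans ?_
      have hu₁ : u₁ ∈ (Gate.prod [u₁, u₂]).args := by simp [Gate.args]
      have hu₂ : u₂ ∈ (Gate.prod [u₁, u₂]).args := by simp [Gate.args]
      -- an input factor: `≤ 1 + |C_j|`
      have hinput : ∀ u u' : Operand k σ, u.isGateRef = false → u' ∈ (Gate.prod [u₁, u₂]).args →
          (u.eval (gateValues (P.gates.take j))).totalDegree +
            (u'.eval (gateValues (P.gates.take j))).totalDegree ≤ (P.subcircuit j).ncard + 1 := by
        intro u u' hin hu'
        have ha := hopIn u hin
        have hb := hop' u' hu'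
        omega
      cases u₁ with
      | var x => exact hinput _ _ rfl hu₂
      | const c => exact hinput _ _ rfl hu₂
      | gate β =>
        cases u₂ with
        | var x => rw [add_comm]; exact hinput _ _ rfl hu₁
        | const c => rw [add_comm]; exact hinput _ _ rfl hu₁
        | gate γ =>
          -- two gate factors: disjoint proper sub-circuits
          have hdisj := hmd.disjoint_of_pair hg
          have hβref : P.References j β := ⟨_, hg, (mem_refs_iff _ β).2 hu₁⟩
          have hγref : P.References j γ := ⟨_, hg, (mem_refs_iff _ γ).2 hu₂⟩
          have hβ := hopGate' β hu₁
          have hγ := hopGate' γ hu₂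
          have hcount := ncard_subcircuit_add_le_of_disjoint P hwf hβref hγref hdisj
          omega
    · simp at hfan

/-- **Bürgisser 2024, after Def. 2.5: "the size of a multiplicatively disjoint circuit provides a
bound on its degree and hence on the degrees of the polynomials computed by it"** — for
well-formed fan-in-two circuits: `deg P.eval ≤ P.size + 1` (the tree's `size` counts gates only;
the survey's `|Φ|` also counts input vertices, whence the `+1`). [cite: Burgisser2024Completeness, Def. 2.5] -/
theorem totalDegree_eval_le_of_isMultiplicativelyDisjoint (hwf : P.WellFormed)
    (h2 : P.IsFanInTwo) (hmd : P.IsMultiplicativelyDisjoint) :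
    P.eval.totalDegree ≤ P.size + 1 := by
  unfold ArithCircuit.eval
  have hout := hwf.2
  cases ho : P.output with
  | var i => exact (isHomogeneous_X k i).totalDegree_le.trans (by omega)
  | const c => simp [Operand.eval]
  | gate j =>
    rw [ho] at hout
    change j < P.size at hout
    rw [Operand.eval_gate]
    exact (totalDegree_gateValue_le_of_isMultiplicativelyDisjoint P hwf h2 hmd j hout).trans
      (by have := ncard_subcircuit_le P hwf j; omega)

end Degree

end ArithCircuit

/-! ## Def. 2.9(1): families of multiplicatively disjoint circuits of polynomial size are in `VP` -/

section Classes

open MvPolynomial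

/-- **Bürgisser 2024, Def. 2.9(1) ⊆ Bürgisser 2000, Def. 2.4 (= the survey's Rem. 2.10(1)).** A
family `f` in p-bounded many variables whose members are computed by well-formed fan-in-two
multiplicatively disjoint circuits of p-bounded size is a `VP` family in the tree's sense
(p-bounded number of variables, degree and complexity): the degree is `≤ size + 1` by the
Def. 2.5 bound. The converse is Prop. 2.6 [MalodPortier2008] (every circuit of size `s` computing
`f` yields a multiplicatively disjoint one of size `O(s · deg)`), not typed here.
[cite: Burgisser2024Completeness, Def. 2.9(1)] -/
theorem isVPFamily_of_isMultiplicativelyDisjoint {k : Type*} [CommSemiring k] {σ : ℕ → Type*}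
    [∀ n, Fintype (σ n)] {f : ∀ n, MvPolynomial (σ n) k}
    (hσ : IsPBounded fun n => Fintype.card (σ n)) {s : ℕ → ℕ} (hs : IsPBounded s)
    (hP : ∀ n, ∃ P : ArithCircuit k (σ n), P.WellFormed ∧ P.IsFanInTwo ∧
      P.IsMultiplicativelyDisjoint ∧ P.Computes (f n) ∧ P.size ≤ s n) :
    IsVPFamily f := by
  refine ⟨⟨hσ, (IsPBounded.add_holds hs (IsPBounded.const 1)).mono fun n => ?_⟩,
    hs.mono fun n => ?_⟩
  · obtain ⟨P, hwf, h2, hmd, hc, hsize⟩ := hP n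
    have h := P.totalDegree_eval_le_of_isMultiplicativelyDisjoint hwf h2 hmd
    have hc' : P.eval = f n := hc
    rw [hc'] at h
    show (f n).totalDegree ≤ s n + 1
    omega
  · obtain ⟨P, -, h2, -, hc, hsize⟩ := hP n
    exact (ArithCircuit.complexity_le_size h2 hc).trans hsize

/-- **`VBP ⊆ VP` in the survey's own definitions (Def. 2.9(1),(2); Rem. 2.8(1)):** a family in
p-bounded many variables computed by well-formed fan-in-two WEAKLY-SKEW circuits of p-bounded size
is a `VP` family, because weakly-skew circuits are multiplicatively disjoint. (Cf.
`IsVPwsFamily.isVPFamily` for the `L_ws`-based class.) [cite: Burgisser2024Completeness, Def. 2.9] -/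
theorem isVPFamily_of_isWeaklySkew {k : Type*} [CommSemiring k] {σ : ℕ → Type*}
    [∀ n, Fintype (σ n)] {f : ∀ n, MvPolynomial (σ n) k}
    (hσ : IsPBounded fun n => Fintype.card (σ n)) {s : ℕ → ℕ} (hs : IsPBounded s)
    (hP : ∀ n, ∃ P : ArithCircuit k (σ n), P.WellFormed ∧ P.IsFanInTwo ∧
      P.IsWeaklySkew ∧ P.Computes (f n) ∧ P.size ≤ s n) :
    IsVPFamily f :=
  isVPFamily_of_isMultiplicativelyDisjoint hσ hs fun n => by
    obtain ⟨P, hwf, h2, hws, hc, hsize⟩ := hP n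
    exact ⟨P, hwf, h2, P.isMultiplicativelyDisjoint_of_isWeaklySkew hwf h2 hws, hc, hsize⟩

end Classes

/-! ## Lemma 4.1(2): the weight bound for constant-free multiplicatively disjoint circuits
(appended; cell `val-lit`, row Bur2024-A, p0015 L28–L39)

> Let us define the weight `wt(f)` of an integer polynomial `f` as the sum of the absolute values
> of its coefficients. It is easy to check that the weight is subadditive and submultiplicative.
> The size of multiplicatively disjoint circuits controls the degree and weight: by induction, one
> easily shows: **Lemma 4.1.** We have `deg(Φ̂_v) ≤ |Φ_v| + 1` and
> `log₂ wt(Φ̂_v) ≤ |Φ_v| + deg(v)` for all gates `v` of a multiplicatively disjoint constant-free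
> arithmetic circuit `Φ`.

With the tree's `weight` (`BurgisserBooleanParts.lean`, Bürgisser 2000 TCS p. 76) and per-gate
formal degrees `gateFormalDegrees` (`ConstantFreeValiant.lean`; `deg(v)` = the formal degree of the
gate `v`, the quantity the induction is about), for well-formed fan-in-two constant-free
(`HasSignConstants`) multiplicatively disjoint circuits over `ℤ`:
`ArithCircuit.weight_gateValue_le_of_isMultiplicativelyDisjoint` —
`wt(value of gate j) ≤ 2 ^ (|C_j| + deg(j))`, and
`ArithCircuit.weight_eval_le_of_isMultiplicativelyDisjoint` — `wt(P.eval) ≤ 2 ^ (size + formal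
degree)`; compare the double-exponential `weight_eval_le_two_pow_two_pow_size` for unrestricted
constant-free circuits. [cite: Burgisser2024Completeness, Lemma 4.1(2)] -/

namespace ArithCircuit

section Weight

variable {σ : Type*}

/-- Earlier formal degrees seen from gate `p` are the final ones. [cite: Burgisser2006, §2.2] -/
private theorem getD_gateFormalDegrees_take_of_lt {k : Type*} (gs : List (Gate k σ)) {i p : ℕ}
    (hi : i < p) : (gateFormalDegrees (gs.take p)).getD i 1 = (gateFormalDegrees gs).getD i 1 := by
  rw [gateFormalDegrees_take_eq_take, List.getD_eq_getElem?_getD, List.getD_eq_getElem?_getD,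
    List.getElem?_take, if_pos hi]

/-- The formal degree recorded for gate `p` is its gate rule applied to the earlier formal degrees.
[cite: Burgisser2006, §2.2] -/
private theorem getD_gateFormalDegrees_eq {k : Type*} (gs : List (Gate k σ)) (p : ℕ) (g : Gate k σ)
    (hg : gs[p]? = some g) :
    (gateFormalDegrees gs).getD p 1 = g.formalDegree (gateFormalDegrees (gs.take p)) := by
  rw [List.getD_eq_getElem?_getD, gateFormalDegrees_getElem?_of_eq gs p g hg, Option.getD_some]

/-- The exponent of Lemma 4.1(2) attached to an operand: `|C_i| + deg(i)` for a gate operand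
`gate i`, `0` for an input operand (weight `≤ 1 = 2⁰`). [cite: Burgisser2024Completeness, Lemma 4.1(2)] -/
noncomputable def mdWeightExponent (P : ArithCircuit ℤ σ) : Operand ℤ σ → ℕ
  | .gate i => (P.subcircuit i).ncard + (gateFormalDegrees P.gates).getD i 1
  | _ => 0

/-- `mdWeightExponent` of a gate operand. [cite: Burgisser2024Completeness, Lemma 4.1(2)] -/
@[simp]
theorem mdWeightExponent_gate (P : ArithCircuit ℤ σ) (i : ℕ) :
    P.mdWeightExponent (.gate i) = (P.subcircuit i).ncard + (gateFormalDegrees P.gates).getD i 1 :=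
  rfl

/-- `mdWeightExponent` of a variable. [cite: Burgisser2024Completeness, Lemma 4.1(2)] -/
@[simp]
theorem mdWeightExponent_var (P : ArithCircuit ℤ σ) (x : σ) : P.mdWeightExponent (.var x) = 0 := rfl

/-- `mdWeightExponent` of a constant. [cite: Burgisser2024Completeness, Lemma 4.1(2)] -/
@[simp]
theorem mdWeightExponent_const (P : ArithCircuit ℤ σ) (c : ℤ) :
    P.mdWeightExponent (.const c) = 0 := rfl

/-- The operands of a constant-free gate are constant-free. [cite: Burgisser2000, §1.4] -/
theorem Gate.hasSignConstants_of_mem_args {k : Type*} [Zero k] [One k] [Add k] {g : Gate k σ}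
    (hg : g.HasSignConstants) : ∀ u ∈ g.args, u.HasSignConstants := by
  intro u hu
  cases g with
  | sum args =>
    simp only [Gate.args, List.mem_map] at hu
    obtain ⟨a, ha, rfl⟩ := hu
    exact (hg a ha).2
  | prod args => exact hg u hu

/-- **Bürgisser 2024, Lemma 4.1(2): `log₂ wt(Φ̂_v) ≤ |Φ_v| + deg(v)`** for every gate `v` of a
well-formed fan-in-two constant-free multiplicatively disjoint circuit over `ℤ`: the value of gate
`j` has weight `≤ 2 ^ (|C_j| + deg(j))`, `C_j` the gates below `j` (`⊆` the survey's `Φ_v`),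
`deg(j)` the formal degree of gate `j`. (Sum gate: `wt ≤ wt(u) + wt(u') ≤ 2 · 2^{max}`, and a
gate operand `i` has `|C_i| + 1 ≤ |C_j|`, `deg(i) ≤ deg(j)`; product gate: `wt ≤ wt(u) · wt(u')`
and the factor sub-circuits are disjoint and proper, `|C_β| + |C_γ| + 1 ≤ |C_j|`,
`deg(j) = deg(β) + deg(γ)`; inputs and sign constants have weight `≤ 1`.)
[cite: Burgisser2024Completeness, Lemma 4.1(2)] -/
theorem weight_gateValue_le_of_isMultiplicativelyDisjoint (P : ArithCircuit ℤ σ)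
    (hwf : P.WellFormed) (h2 : P.IsFanInTwo) (hsc : P.HasSignConstants)
    (hmd : P.IsMultiplicativelyDisjoint) :
    ∀ j : ℕ, j < P.size →
      weight ((gateValues P.gates).getD j 0) ≤
        2 ^ ((P.subcircuit j).ncard + (gateFormalDegrees P.gates).getD j 1) := by
  intro j
  induction j using Nat.strong_induction_on with
  | _ j ih =>
  intro hj
  obtain ⟨g, hg⟩ : ∃ g, P.gates[j]? = some g := ⟨P.gates[j]'hj, List.getElem?_eq_getElem hj⟩
  have hgsc : g.HasSignConstants := hsc.1 g (List.mem_of_getElem? hg)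
  have hargsc := Gate.hasSignConstants_of_mem_args hgsc
  rw [getD_gateValues_eq_eval P.gates j g hg, getD_gateFormalDegrees_eq P.gates j g hg]
  have hone : 1 ≤ (P.subcircuit j).ncard :=
    (Set.ncard_pos (subcircuit_finite P hwf j)).2 ⟨j, self_mem_subcircuit P j⟩
  -- (W) the weight of an operand is at most `2 ^ exponent`
  have hW : ∀ u ∈ g.args, weight (u.eval (gateValues (P.gates.take j))) ≤
      2 ^ P.mdWeightExponent u := by
    intro u hu
    cases u with
    | var x => simp [Operand.eval]
    | const c =>
      simp only [Operand.eval, weight_C, mdWeightExponent_const, pow_zero]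
      exact natAbs_le_one_of_isSignConstant (hargsc _ hu)
    | gate i =>
      have hub : i < j := hwf.1 j g hg (.gate i) hu
      simp only [Operand.eval_gate, mdWeightExponent_gate]
      rw [getD_gateValues_take_of_lt P.gates hub]
      exact ih i hub (hub.trans hj)
  -- (S) exponent of an operand `+ 1 ≤ |C_j| +` its formal degree
  have hS : ∀ u ∈ g.args, P.mdWeightExponent u + 1 ≤
      (P.subcircuit j).ncard + u.formalDegree (gateFormalDegrees (P.gates.take j)) := by
    intro u hu
    cases u with
    | var x => simp only [mdWeightExponent_var, Operand.formalDegree]; omega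
    | const c => simp only [mdWeightExponent_const, Operand.formalDegree]; omega
    | gate i =>
      have hub : i < j := hwf.1 j g hg (.gate i) hu
      have href : P.References j i := ⟨g, hg, (mem_refs_iff g i).2 hu⟩
      have hcnt := ncard_subcircuit_succ_le P hwf href
      simp only [mdWeightExponent_gate, Operand.formalDegree]
      rw [getD_gateFormalDegrees_take_of_lt P.gates hub]
      omega
  have hpow : ∀ {a b : ℕ}, a ≤ b → (2 : ℕ) ^ a ≤ 2 ^ b := fun h => Nat.pow_le_pow_right two_pos h
  cases g with
  | sum args =>
    have hfan : args.length ≤ 2 := by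
      have := h2 (.sum args) (List.mem_of_getElem? hg)
      simpa [Gate.fanIn, Gate.args] using this
    -- each summand: `2 · wt ≤ 2 ^ (|C_j| + max formal degree)`
    have hterm : ∀ a ∈ args,
        2 * weight (a.1 • a.2.eval (gateValues (P.gates.take j))) ≤
          2 ^ ((P.subcircuit j).ncard +
            a.2.formalDegree (gateFormalDegrees (P.gates.take j))) := by
      intro a ha
      have hmem : a.2 ∈ (Gate.sum args).args := by
        simp only [Gate.args, List.mem_map]
        exact ⟨a, ha, rfl⟩
      have h1 := (weight_smul_le_of_isSignConstant (hgsc a ha).1 _).trans (hW a.2 hmem)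
      calc 2 * weight (a.1 • a.2.eval (gateValues (P.gates.take j)))
          ≤ 2 * 2 ^ P.mdWeightExponent a.2 := Nat.mul_le_mul_left 2 h1
        _ = 2 ^ (P.mdWeightExponent a.2 + 1) := by rw [pow_succ, mul_comm]
        _ ≤ _ := hpow (hS a.2 hmem)
    simp only [Gate.eval, Gate.formalDegree]
    rcases args with _ | ⟨a, _ | ⟨b, _ | ⟨c, rest⟩⟩⟩
    · simp
    · simp only [List.map_cons, List.map_nil, List.sum_cons, List.sum_nil, add_zero,
        List.foldr_cons, List.foldr_nil]
      have h := hterm a (by simp)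
      have hm : a.2.formalDegree (gateFormalDegrees (P.gates.take j)) ≤
          max (a.2.formalDegree (gateFormalDegrees (P.gates.take j))) 0 := le_max_left _ _
      have h' := hpow (Nat.add_le_add_left hm (P.subcircuit j).ncard)
      omega
    · simp only [List.map_cons, List.map_nil, List.sum_cons, List.sum_nil, add_zero,
        List.foldr_cons, List.foldr_nil]
      refine (weight_add_le _ _).trans ?_
      have ha := hterm a (by simp)
      have hb := hterm b (by simp)
      have hma : a.2.formalDegree (gateFormalDegrees (P.gates.take j)) ≤
          max (a.2.formalDegree (gateFormalDegrees (P.gates.take j)))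
            (max (b.2.formalDegree (gateFormalDegrees (P.gates.take j))) 0) := le_max_left _ _
      have hmb : b.2.formalDegree (gateFormalDegrees (P.gates.take j)) ≤
          max (a.2.formalDegree (gateFormalDegrees (P.gates.take j)))
            (max (b.2.formalDegree (gateFormalDegrees (P.gates.take j))) 0) :=
        (le_max_left _ _).trans (le_max_right _ _)
      have ha' := hpow (Nat.add_le_add_left hma (P.subcircuit j).ncard)
      have hb' := hpow (Nat.add_le_add_left hmb (P.subcircuit j).ncard)
      omega
    · simp at hfan
  | prod args =>
    have hfan : args.length ≤ 2 := by
      have := h2 (.prod args) (List.mem_of_getElem? hg)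
      simpa [Gate.fanIn, Gate.args] using this
    simp only [Gate.eval, Gate.formalDegree]
    rcases args with _ | ⟨u₁, _ | ⟨u₂, _ | ⟨u₃, rest⟩⟩⟩
    · simp only [List.map_nil, List.prod_nil, weight_one, List.sum_nil, add_zero]
      exact Nat.one_le_two_pow
    · simp only [List.map_cons, List.map_nil, List.prod_cons, List.prod_nil, mul_one,
        List.sum_cons, List.sum_nil, add_zero]
      have h := hW u₁ (by simp [Gate.args])
      have h' := hpow (hS u₁ (by simp [Gate.args]))
      have h'' : 2 ^ P.mdWeightExponent u₁ ≤ 2 ^ (P.mdWeightExponent u₁ + 1) := hpow (by omega)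
      omega
    · simp only [List.map_cons, List.map_nil, List.prod_cons, List.prod_nil, mul_one,
        List.sum_cons, List.sum_nil, add_zero]
      have hu₁ : u₁ ∈ (Gate.prod [u₁, u₂]).args := by simp [Gate.args]
      have hu₂ : u₂ ∈ (Gate.prod [u₁, u₂]).args := by simp [Gate.args]
      refine (weight_mul_le _ _).trans ((Nat.mul_le_mul (hW u₁ hu₁) (hW u₂ hu₂)).trans ?_)
      rw [← pow_add]
      refine hpow ?_
      -- exponent bookkeeping: `E(u₁) + E(u₂) ≤ |C_j| + deg(u₁) + deg(u₂)`
      have hS₁ := hS u₁ hu₁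
      have hS₂ := hS u₂ hu₂
      cases u₁ with
      | var x => simp only [mdWeightExponent_var] at hS₁ ⊢; omega
      | const c => simp only [mdWeightExponent_const] at hS₁ ⊢; omega
      | gate β =>
        cases u₂ with
        | var x => simp only [mdWeightExponent_var] at hS₂ ⊢; omega
        | const c => simp only [mdWeightExponent_const] at hS₂ ⊢; omega
        | gate γ =>
          have hdisj := hmd.disjoint_of_pair hg
          have hβref : P.References j β := ⟨_, hg, (mem_refs_iff _ β).2 hu₁⟩
          have hγref : P.References j γ := ⟨_, hg, (mem_refs_iff _ γ).2 hu₂⟩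
          have hcount := ncard_subcircuit_add_le_of_disjoint P hwf hβref hγref hdisj
          have hβlt : β < j := hwf.1 j _ hg (.gate β) hu₁
          have hγlt : γ < j := hwf.1 j _ hg (.gate γ) hu₂
          simp only [mdWeightExponent_gate, Operand.formalDegree]
          rw [getD_gateFormalDegrees_take_of_lt P.gates hβlt,
            getD_gateFormalDegrees_take_of_lt P.gates hγlt]
          omega
    · simp at hfan

/-- **Bürgisser 2024, Lemma 4.1(2) at the output:** a well-formed fan-in-two constant-free
multiplicatively disjoint circuit over `ℤ` computes a polynomial of weight
`≤ 2 ^ (size + formal degree)` (single-exponential, versus `2 ^ 2 ^ size` for unrestricted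
constant-free circuits, `weight_eval_le_two_pow_two_pow_size`). [cite: Burgisser2024Completeness, Lemma 4.1(2)] -/
theorem weight_eval_le_of_isMultiplicativelyDisjoint (P : ArithCircuit ℤ σ) (hwf : P.WellFormed)
    (h2 : P.IsFanInTwo) (hsc : P.HasSignConstants) (hmd : P.IsMultiplicativelyDisjoint) :
    weight P.eval ≤ 2 ^ (P.size + P.formalDegree) := by
  unfold ArithCircuit.eval ArithCircuit.formalDegree
  have hout := hwf.2
  have hosc := hsc.2
  cases ho : P.output with
  | var i => simp only [Operand.eval, weight_X]; exact Nat.one_le_two_pow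
  | const c =>
    rw [ho] at hosc
    simp only [Operand.eval, weight_C]
    exact (natAbs_le_one_of_isSignConstant hosc).trans Nat.one_le_two_pow
  | gate j =>
    rw [ho] at hout
    change j < P.size at hout
    rw [Operand.eval_gate]
    refine (weight_gateValue_le_of_isMultiplicativelyDisjoint P hwf h2 hsc hmd j hout).trans
      (Nat.pow_le_pow_right two_pos ?_)
    have := ncard_subcircuit_le P hwf j
    simp only [Operand.formalDegree]
    omega

end Weight

end ArithCircuit

end Literature.Computability.AlgebraicComplexity
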